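import Summits.ABC.IUTFork.Thm311RealIsmDHMover
import Literature.IUT.LogThetaLattice.HolomorphicLogShellUnramified
import HarnessLib

/-!
# [IUTchIII] Cor. 3.12, TEAM R: at UNRAMIFIED places (`p` odd) every element of Dupuy–Hilado's (Ind2) family
# `Real.ismDH` is an ISOMETRY of `K_v` — the complement of the ramified movers p421508/p427624/p427994

PROOF-ONLY file (abc-iut cell, WAVE-5 seat abc-iut-w5-d216 gen 2; TEAM R indFixes thread, lead R1 =
abc-iut-c312-14); TAKES NO SIDE on [IUTchIII] Cor. 3.12.  Classical valuation theory.

The ramified movers of this seat (p421508 `exists_ismDH_moves_smul_shell`, p422813, p427624, p427994) refute R-1's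
identified-copies READING AS TYPED at any tame quadratically ramified place `v₀ | p ≥ 5`.  This file records the
other side of the dichotomy, for the adjudication record (in particular for the pilot datum of record over
`F = ℚ`, where NO finite place is ramified): at a finite place `v | p` with `p ≠ 2` and `e(v|p) = 1`, the DH
log-shell of the analytic logarithm is the closed unit ball `𝒪_v` of the rescaled completion
(abc-iut-L4's `logShell_ofUnitLog_eq_closedBall_of_unramified`, [AbsTopIII] Def. 5.4 (iii) last sentence), and
every bicontinuous `ℚ`-linear `φ` with `φ(I_v) = I_v` — every element of `Real.ismDH (analyticLogv F) v` — is
`ℚ_p`-linear (continuity + density of `ℚ` in `ℚ_p`), maps EVERY ball `p^k·𝒪_v` onto itself, hence, the value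
group being `p^ℤ`, PRESERVES THE NORM of every element.  So at unramified places DH's (Ind2) family lies inside
the isometry reading of R1's positive horn `Cor312.Setting.ofComparison_identify_identifiedReading_of_isometries`;
the negative phenomenon of p427624 is a feature of RAMIFIED base fields.  Nothing here asserts the positive horn's
remaining hypotheses ((Ind1), the comparison transport) — that is R1's. 

Decls: `IsmDHUnram.map_smul_of_continuous` (continuous additive ⇒ `ℚ_p`-homogeneous), `IsmDHUnram.image_smul_set`,
`IsmDHUnram.norm_eq_of_iff` (two elements of `p^ℤ`-norm with the same ball profile have the same norm),
`shell_analyticLogv_eq_image_closedBall_one` (the unramified shell), `norm_of_map_eq_of_mem_ismDH_unramified`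
(isometry in the rescaled norm), `norm_map_eq_of_mem_ismDH_unramified` (isometry in the norm of `K_v`),
`ismDH_image_closedBall_of_unramified` (every ball centred at `0` is mapped onto itself).  Axioms: standard three.
-/

noncomputable section

open Metric Set Function
open scoped Pointwise

namespace Summit.ABC.IUTFork.Thm311.Real

open Literature.IUT.LogVolume Literature.NumberTheory.NumberFields
open Literature.NumberTheory.GaloisRepresentations.Ultrametric
open Literature.AnabelianGeometry.AbsoluteAnabelian
open Literature.IUT.LogThetaLattice (logShell_ofUnitLog_eq_closedBall_of_unramified)
open NumberField IsDedekindDomain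

/-! ## 1. Generic: continuity upgrades `ℚ`-additivity to `ℚ_p`-linearity; discrete norms are read off balls -/

namespace IsmDHUnram

section Generic

variable {p : ℕ} [Fact p.Prime] {K : Type} [NontriviallyNormedField K] [NormedAlgebra ℚ_[p] K]

/-- A continuous additive self-map of a normed `ℚ_p`-algebra is `ℚ_p`-homogeneous (it is `ℚ`-homogeneous, `ℚ` is
dense in `ℚ_p`, and both sides are continuous in the scalar). [folklore] -/
theorem map_smul_of_continuous (f : K →+ K) (hf : Continuous f) (c : ℚ_[p]) (y : K) : f (c • y) = c • f y := by
  have h1 : Continuous fun c : ℚ_[p] => f (c • y) := hf.comp (continuous_id.smul continuous_const)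
  have h2 : Continuous fun c : ℚ_[p] => c • f y := continuous_id.smul continuous_const
  have h := (Padic.denseRange_ratCast p).equalizer h1 h2 (funext fun q => by
    simp only [Function.comp_apply]
    exact map_ratCast_smul f ℚ_[p] ℚ_[p] q y)
  exact congrFun h c

/-- Hence such a map commutes with scaling of sets: `f(c·S) = c·f(S)`. [folklore] -/
theorem image_smul_set (f : K →+ K) (hf : Continuous f) (c : ℚ_[p]) (S : Set K) :
    f '' (c • S) = c • (f '' S) := by
  ext z
  simp only [Set.mem_image, Set.mem_smul_set]
  constructor
  · rintro ⟨x, ⟨s, hs, rfl⟩, rfl⟩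
    exact ⟨f s, ⟨s, hs, rfl⟩, (map_smul_of_continuous f hf c s).symm⟩
  · rintro ⟨w, ⟨s, hs, rfl⟩, rfl⟩
    exact ⟨c • s, ⟨s, hs, rfl⟩, map_smul_of_continuous f hf c s⟩

omit [NormedAlgebra ℚ_[p] K] in
/-- Two elements whose norms are integral powers of `b` and which lie in the same balls `B(0, b^k)` (`k ∈ ℤ`) have
the same norm. [folklore] -/
theorem norm_eq_of_iff {b : ℝ} {x y : K} (hx : ∃ m : ℤ, ‖x‖ = b ^ m) (hy : ∃ m : ℤ, ‖y‖ = b ^ m)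
    (h : ∀ k : ℤ, ‖x‖ ≤ b ^ k ↔ ‖y‖ ≤ b ^ k) : ‖x‖ = ‖y‖ := by
  obtain ⟨m, hm⟩ := hx
  obtain ⟨m', hm'⟩ := hy
  refine le_antisymm ?_ ?_
  · have := (h m').mpr (le_of_eq hm'); rwa [← hm'] at this
  · have := (h m).mp (le_of_eq hm); rwa [← hm] at this

omit [Fact p.Prime] [NormedAlgebra ℚ_[p] K] in
/-- In a normed field with a norm uniformizer of norm `p⁻¹` (absolute ramification index `1`), every non-zero
element has norm an integral power of `p`. [folklore] -/
theorem exists_norm_eq_zpow {ϖ : Kˣ} (hϖ : IsUniformizer ϖ) (hϖp : ‖(ϖ : K)‖ = (p : ℝ)⁻¹) {x : K} (hx : x ≠ 0) :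
    ∃ m : ℤ, ‖x‖ = (p : ℝ) ^ m := by
  refine ⟨-hϖ.ordFun (Units.mk0 x hx), ?_⟩
  have h := hϖ.norm_eq_zpow_ordFun (Units.mk0 x hx)
  rw [Units.val_mk0] at h
  rw [h, hϖp, inv_zpow']

end Generic

end IsmDHUnram

/-! ## 2. At an unramified place: the shell is `𝒪_v`, and `ismDH` acts by isometries -/

section Instance

variable {F : Type} [Field F] [NumberField F] (p : ℕ) [Fact p.Prime] (v : HeightOneSpectrum (𝓞 F))
  (hv : ((p : ℕ) : 𝓞 F) ∈ v.asIdeal)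

/-- **The log-shell of the analytic logarithm at an unramified place of odd residue characteristic is the closed
unit ball `𝒪_v`** of the rescaled completion (read back along `of`): abc-iut-L4's
`logShell_ofUnitLog_eq_closedBall_of_unramified` ([AbsTopIII] Def. 5.4 (iii), last sentence: "if `k` is absolutely
unramified and `p_k` is odd, then `𝒪 = ℐ`") at the shell formula of `Cor312Ind3Analytic`.
[cite: MochizukiAbsTopIII2015, Def. 5.4 (iii) p. 126] -/
theorem shell_analyticLogv_eq_image_closedBall_one (hp : residueChar F v = p) (hp2 : p ≠ 2)
    (he : v.asIdeal.ramificationIdx ℤ = 1) :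
    shell (analyticLogv F) (.inr v) =
      (RescaledCompletion.of F p v hv).symm '' closedBall (0 : RescaledCompletion F p v hv) 1 := by
  subst hp
  rw [shell_eq_image_logShell_of_formula (residueChar F v) v hv (analyticLogv F) rfl
      (fun u => analyticLogv_apply F v u),
    logShell_ofUnitLog_eq_closedBall_of_unramified (residueChar F v) (RescaledCompletion F (residueChar F v) v hv)
      hp2 ((absRamificationIdx_rescaledCompletion F (residueChar F v) v hv).trans he)]

/-- **At an unramified place of odd residue characteristic every element of DH's (Ind2) family is an isometry of
the rescaled completion**: for `φ ∈ Real.ismDH (analyticLogv F) v` (bicontinuous, `ℚ`-linear, `φ(I_v) = I_v`) and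
every `x ∈ K_v`, `‖φ x‖ = ‖x‖` in `K_v^{(1/n_v)}`.  Proof: `φ` is `ℚ_p`-linear (`map_smul_of_continuous`), so
`φ(p^k 𝒪_v) = p^k φ(𝒪_v) = p^k 𝒪_v` for all `k ∈ ℤ` (`I_v = 𝒪_v` by `shell_analyticLogv_eq_image_closedBall_one`);
the balls `p^k 𝒪_v = B(0, p^{-k})` exhaust the balls of `K_v` and the value group is `p^ℤ` (`e = 1`), so the ball
profile of `φ x` equals that of `x`, whence the norms agree (`norm_eq_of_iff`). [cite: DupuyHilado2025, §4.9] -/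
theorem norm_of_map_eq_of_mem_ismDH_unramified (hp : residueChar F v = p) (hp2 : p ≠ 2)
    (he : v.asIdeal.ramificationIdx ℤ = 1)
    {φ : Carrier (.inr v : Place F) ≃ₗ[ℚ] Carrier (.inr v : Place F)}
    (hφ : φ ∈ ismDH (analyticLogv F) (.inr v : Place F)) (x : Carrier (.inr v : Place F)) :
    ‖RescaledCompletion.of F p v hv (φ x)‖ = ‖RescaledCompletion.of F p v hv x‖ := by
  set K := RescaledCompletion F p v hv
  let e : Carrier (.inr v : Place F) ≃+* K := RescaledCompletion.of F p v hv
  obtain ⟨hc, -, himg⟩ := hφ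
  -- `φ` read on `K` (the identity `e` is a homeomorphism: same uniform structure)
  let f : K →+ K := (e.symm.toAddEquiv.trans (φ.toAddEquiv.trans e.toAddEquiv)).toAddMonoidHom
  have hfc : Continuous f := hc
  have hfinj : Function.Injective f := (e.symm.toAddEquiv.trans (φ.toAddEquiv.trans e.toAddEquiv)).injective
  -- the shell is the unit ball, mapped onto itself
  have hshell : shell (analyticLogv F) (.inr v) = e.symm '' closedBall (0 : K) 1 :=
    shell_analyticLogv_eq_image_closedBall_one p v hv hp hp2 he
  have hball : f '' closedBall (0 : K) 1 = closedBall (0 : K) 1 := by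
    have h1 : f '' closedBall (0 : K) 1 = e '' (⇑φ '' (e.symm '' closedBall (0 : K) 1)) := by
      rw [Set.image_image, Set.image_image]
      rfl
    rw [h1, ← hshell, himg, hshell, Set.image_image]
    simp only [RingEquiv.apply_symm_apply, Set.image_id']
  -- every ball `B(0, p^k)` is mapped onto itself
  have hballk : ∀ k : ℤ, f '' closedBall (0 : K) ((p : ℝ) ^ k) = closedBall (0 : K) ((p : ℝ) ^ k) := by
    intro k
    have hck : ‖((p : ℚ_[p]) ^ (-k))‖ = (p : ℝ) ^ k := by rw [Padic.norm_p_zpow, neg_neg]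
    have hsm : ((p : ℚ_[p]) ^ (-k)) • closedBall (0 : K) 1 = closedBall (0 : K) ((p : ℝ) ^ k) := by
      rw [_root_.smul_closedBall _ _ zero_le_one, smul_zero, hck, mul_one]
    rw [← hsm, IsmDHUnram.image_smul_set f hfc, hball]
  have hiff : ∀ (k : ℤ) (y : K), ‖y‖ ≤ (p : ℝ) ^ k ↔ ‖f y‖ ≤ (p : ℝ) ^ k := by
    intro k y
    rw [← mem_closedBall_zero_iff, ← mem_closedBall_zero_iff, ← hfinj.mem_set_image, hballk]
  -- the value group is `p^ℤ`
  obtain ⟨-, ϖ, hϖ, -⟩ : True ∧ ∃ ϖ : Kˣ, IsUniformizer ϖ ∧ True := by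
    obtain ⟨ϖ, hϖ⟩ := exists_isUniformizer (F := K)
    exact ⟨trivial, ϖ, hϖ, trivial⟩
  have hϖp : ‖(ϖ : K)‖ = (p : ℝ)⁻¹ := by
    have h := norm_pow_absRamificationIdx p K hϖ
    rwa [(absRamificationIdx_rescaledCompletion F p v hv).trans he, pow_one] at h
  -- conclusion
  show ‖f (e x)‖ = ‖e x‖
  by_cases hx : e x = 0
  · rw [hx, map_zero]
  have hfx : f (e x) ≠ 0 := fun h0 => hx (hfinj (h0.trans (map_zero f).symm))
  exact (IsmDHUnram.norm_eq_of_iff (IsmDHUnram.exists_norm_eq_zpow hϖ hϖp hx)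
    (IsmDHUnram.exists_norm_eq_zpow hϖ hϖp hfx) (fun k => hiff k (e x))).symm

/-- The same in the norm `|·|_v` of `K_v` itself (`|y|_v = ‖of y‖^{n_v}`). [cite: DupuyHilado2025, §4.9] -/
theorem norm_map_eq_of_mem_ismDH_unramified (hp : residueChar F v = p) (hp2 : p ≠ 2)
    (he : v.asIdeal.ramificationIdx ℤ = 1)
    {φ : Carrier (.inr v : Place F) ≃ₗ[ℚ] Carrier (.inr v : Place F)}
    (hφ : φ ∈ ismDH (analyticLogv F) (.inr v : Place F)) (x : Carrier (.inr v : Place F)) :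
    ‖φ x‖ = ‖x‖ := by
  have hv' : ((p : ℕ) : 𝓞 F) ∈ v.asIdeal := hp ▸ natCast_residueChar_mem F v
  -- `|y|_v = ‖of y‖^{n_v}` (the norm of `Carrier (inr v)` is Mathlib's `v`-adic norm, definitionally)
  have h1 : ‖φ x‖ = ‖RescaledCompletion.of F p v hv' (φ x)‖ ^ localDeg F v :=
    RescaledCompletion.norm_eq_norm_of_pow F p v hv' (φ x)
  have h2 : ‖x‖ = ‖RescaledCompletion.of F p v hv' x‖ ^ localDeg F v :=
    RescaledCompletion.norm_eq_norm_of_pow F p v hv' x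
  rw [h1, h2, norm_of_map_eq_of_mem_ismDH_unramified p v hv' hp hp2 he hφ x]

/-- **Consequently every closed ball of `K_v` centred at `0` is mapped ONTO ITSELF by every element of DH's (Ind2)
family at an unramified place of odd residue characteristic** — in particular every multiple `c·I_v` of the
log-shell (contrast p421508 `exists_ismDH_moves_smul_shell` at tame quadratically ramified places).
[cite: DupuyHilado2025, §4.9] -/
theorem ismDH_image_closedBall_of_unramified (hp : residueChar F v = p) (hp2 : p ≠ 2)
    (he : v.asIdeal.ramificationIdx ℤ = 1)
    {φ : Carrier (.inr v : Place F) ≃ₗ[ℚ] Carrier (.inr v : Place F)}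
    (hφ : φ ∈ ismDH (analyticLogv F) (.inr v : Place F)) (r : ℝ) :
    ⇑φ '' closedBall (0 : Carrier (.inr v : Place F)) r = closedBall 0 r := by
  ext y
  simp only [Set.mem_image, mem_closedBall_zero_iff]
  constructor
  · rintro ⟨x, hx, rfl⟩
    rwa [norm_map_eq_of_mem_ismDH_unramified p v hp hp2 he hφ x]
  · intro hy
    refine ⟨φ.symm y, ?_, φ.apply_symm_apply y⟩
    rw [← norm_map_eq_of_mem_ismDH_unramified p v hp hp2 he hφ (φ.symm y), φ.apply_symm_apply]
    exact hy

end Instance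

end Summit.ABC.IUTFork.Thm311.Real
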